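import Summits.AtomisticToContinuum.BoseEinsteinCondensation.Theorems.BoxCountShadowDisplacementSib
import HarnessLib

/-!
# BoxCountShadowCountParity — refinement monotonicity of the count affinity and the parity lift for NUM_h

File 11 of lens-6 g36 (optional complement to files 9–10).  Content:

* `countAffinity_double_le`: `countAffinity L (2K') Φ ≤ countAffinity L K' Φ` — the count (insertion) affinity
  can only grow under coarsening of the grid (data processing of the Bhattacharyya coefficient along the
  children-sum map of count fields, plus Cauchy–Schwarz over the ≤ 8 children of a coarse cell);
* `horizonCountAffinity_of_even`: NUM^e_h(η) → NUM_h(η) (the parity restriction of file 10 is immaterial for NUM_h: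
  for `K` in the window of constant `2M`, `2K` is even and lies in the window of constant `M`);
* `horizonCountAffinity_of_loc`: LOC_h(η) ∧ CSUF_h(η) ⟹ NUM_h(η), and the iff
  `horizonCountSufficiency_iff_countAffinity_of_loc`: given LOC_h(η), CSUF_h(η) ↔ NUM_h(η)
  (with DLT_h(η) discharged by `CoercivityLine.densityLLNTrunc_holds`).

So, modulo the energy-class piece LOC_h(η), the two «global» leaves CSUF_h and NUM_h of the box count-shadow line are
literally equivalent.  No instances, no notation, no sorry.
-/

noncomputable section

open MeasureTheory Filter Set
open scoped ENNReal NNReal BigOperators Topology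

namespace Summit.AtomisticToContinuum.BoseEinsteinCondensation.Theorems.BoxCountShadow

open Literature.MathematicalPhysics.QuantumManyBody.BoseGas
open Summit.AtomisticToContinuum.BoseEinsteinCondensation.Theorems.BoxLatticeFSum
open Summit.AtomisticToContinuum.BoseEinsteinCondensation.Theorems.BoxLabelAffinity
open Summit.AtomisticToContinuum.BoseEinsteinCondensation.Theorems.BoxHorizonAffinity

variable {n : ℕ}

/-! ### Elementary pieces -/

/-- Cauchy–Schwarz for square roots over a finite set: `Σ_{i∈s} y_i^{1/2} ≤ (#s)^{1/2} (Σ_{i∈s} y_i)^{1/2}`.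
[folklore] -/
theorem sum_rpow_half_le_sqrt_card_mul {ι : Type*} (s : Finset ι) (y : ι → ℝ≥0∞) :
    ∑ i ∈ s, y i ^ (1 / 2 : ℝ) ≤ (s.card : ℝ≥0∞) ^ (1 / 2 : ℝ) * (∑ i ∈ s, y i) ^ (1 / 2 : ℝ) := by
  have h := ENNReal.rpow_sum_le_const_mul_sum_rpow s (fun i => y i ^ (1 / 2 : ℝ)) (p := 2) (by norm_num)
  have hsq : ∀ i, (y i ^ (1 / 2 : ℝ)) ^ (2 : ℝ) = y i := fun i => by
    rw [← ENNReal.rpow_mul]; norm_num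
  simp only [hsq] at h
  have h' : (∑ i ∈ s, y i ^ (1 / 2 : ℝ)) ^ (2 : ℝ) ≤ (s.card : ℝ≥0∞) * ∑ i ∈ s, y i := by
    refine h.trans (mul_le_mul' ?_ le_rfl)
    norm_num
  calc ∑ i ∈ s, y i ^ (1 / 2 : ℝ)
      = ((∑ i ∈ s, y i ^ (1 / 2 : ℝ)) ^ (2 : ℝ)) ^ (1 / 2 : ℝ) := by
        rw [← ENNReal.rpow_mul]; norm_num
    _ ≤ ((s.card : ℝ≥0∞) * ∑ i ∈ s, y i) ^ (1 / 2 : ℝ) := ENNReal.rpow_le_rpow h' (by norm_num)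
    _ = (s.card : ℝ≥0∞) ^ (1 / 2 : ℝ) * (∑ i ∈ s, y i) ^ (1 / 2 : ℝ) :=
        ENNReal.mul_rpow_of_nonneg _ _ (by norm_num)

/-- Swapping a `tsum` with a weighted finite sum: `Σ'_m f(m) Σ_i w_i g_i(m) = Σ_i w_i Σ'_m f(m) g_i(m)`. [folklore] -/
theorem tsum_mul_sum_swap {σ ι : Type*} [Fintype ι] (f : σ → ℝ≥0∞) (w : ι → ℝ≥0∞) (g : ι → σ → ℝ≥0∞) :
    ∑' m, f m * ∑ i, w i * g i m = ∑ i, w i * ∑' m, f m * g i m := by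
  have hpt : ∀ m, f m * ∑ i, w i * g i m = ∑ i, w i * (f m * g i m) := fun m => by
    rw [Finset.mul_sum]
    exact Finset.sum_congr rfl fun i _ => by ring
  simp_rw [hpt]
  rw [Summable.tsum_finsetSum (fun _ _ => ENNReal.summable)]
  exact Finset.sum_congr rfl fun i _ => ENNReal.tsum_mul_left

/-- The real identity behind `w_{K'} = 8^{1/2} w_{2K'}`: `√8 · (√(1/(2k)))³ = (√(1/k))³` for `k > 0`. [folklore] -/
theorem sqrt_eight_mul_sqrt_inv_double_cube {k : ℝ} (hk : 0 < k) :
    Real.sqrt 8 * Real.sqrt (1 / (2 * k)) ^ 3 = Real.sqrt (1 / k) ^ 3 := by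
  have e1 : Real.sqrt (1 / (2 * k)) = Real.sqrt (1 / 2) * Real.sqrt (1 / k) := by
    rw [← Real.sqrt_mul (by norm_num : (0:ℝ) ≤ 1 / 2)]
    congr 1
    field_simp
  have e2 : Real.sqrt 8 * Real.sqrt (1 / 2) = 2 := by
    rw [← Real.sqrt_mul (by norm_num : (0:ℝ) ≤ 8), show (8:ℝ) * (1 / 2) = 2 ^ 2 by norm_num]
    exact Real.sqrt_sq (by norm_num)
  have e3 : Real.sqrt (1 / 2) ^ 2 = 1 / 2 := Real.sq_sqrt (by norm_num)
  calc Real.sqrt 8 * Real.sqrt (1 / (2 * k)) ^ 3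
      = (Real.sqrt 8 * Real.sqrt (1 / 2)) * Real.sqrt (1 / 2) ^ 2 * Real.sqrt (1 / k) ^ 3 := by
        rw [e1]; ring
    _ = Real.sqrt (1 / k) ^ 3 := by rw [e2, e3]; ring

/-- **Weights under dyadic refinement**: `8^{1/2} · w_{2K'} = w_{K'}`. [folklore] -/
theorem sqrt_eight_mul_blockWeight_double {K' : ℕ} (hK' : 0 < K') :
    (8 : ℝ≥0∞) ^ (1 / 2 : ℝ) * blockWeight (2 * K') = blockWeight K' := by
  have hk : (0:ℝ) < (K' : ℝ) := by exact_mod_cast hK'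
  have h8 : (8 : ℝ≥0∞) ^ (1 / 2 : ℝ) = ENNReal.ofReal (Real.sqrt 8) := by
    rw [show (8 : ℝ≥0∞) = ENNReal.ofReal 8 by norm_num,
      ENNReal.ofReal_rpow_of_nonneg (by norm_num) (by norm_num), ← Real.sqrt_eq_rpow]
  unfold blockWeight
  rw [h8, ← ENNReal.ofReal_mul (Real.sqrt_nonneg _)]
  congr 1
  push_cast
  exact sqrt_eight_mul_sqrt_inv_double_cube hk

/-- For a coarse cell `P`: `(#children)^{1/2} · w_{2K'} ≤ w_{K'}` (at most 8 children). [folklore] -/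
theorem sqrt_card_children_mul_blockWeight_le {K' : ℕ} (hK' : 0 < K') (P : SubIdx K') :
    ((children (2 * K') P).card : ℝ≥0∞) ^ (1 / 2 : ℝ) * blockWeight (2 * K') ≤ blockWeight K' := by
  rw [← sqrt_eight_mul_blockWeight_double hK']
  refine mul_le_mul' (ENNReal.rpow_le_rpow ?_ (by norm_num)) le_rfl
  exact_mod_cast card_children_le_eight P

/-! ### The count field under dyadic coarsening -/

/-- **Coarse counts are children sums**: `m^{(2ℓ)}_P(Y) = Σ_{C child of P} m^{(ℓ)}_C(Y)`. [folklore] -/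
theorem countVec_coarse_eq_sum {K' : ℕ} {ℓ : ℝ} (hℓ : 0 < ℓ) (Y : Config n) (P : SubIdx K') :
    countVec (2 * ℓ) K' Y P = ∑ C ∈ children (2 * K') P, countVec ℓ (2 * K') Y C := by
  classical
  unfold countVec
  rw [Finset.sum_comm]
  refine Finset.sum_congr rfl fun i _ => ?_
  -- the indicator of the disjoint union of the children is the sum of their indicators
  by_cases hx : ∃ C ∈ children (2 * K') P, Y i ∈ subCell ℓ C
  · obtain ⟨C, hC, hYC⟩ := hx
    have hmem : Y i ∈ subCell (2 * ℓ) P := by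
      rw [subCell_coarse_eq_biUnion hℓ P]
      exact Set.mem_iUnion₂.2 ⟨C, hC, hYC⟩
    rw [Set.indicator_of_mem hmem, Finset.sum_eq_single C, Set.indicator_of_mem hYC]
    · intro D hD hDC
      exact Set.indicator_of_notMem (fun hYD => not_mem_subCell_of_ne hℓ hDC hYD hYC) _
    · exact fun h => (h hC).elim
  · push Not at hx
    have hnot : Y i ∉ subCell (2 * ℓ) P := by
      rw [subCell_coarse_eq_biUnion hℓ P]
      intro h
      obtain ⟨C, hC, hYC⟩ := Set.mem_iUnion₂.1 h
      exact hx C hC hYC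
    rw [Set.indicator_of_notMem hnot]
    exact (Finset.sum_eq_zero fun C hC => Set.indicator_of_notMem (hx C hC) _).symm

/-- The children-sum map on count configurations `π : ℕ^{(2K')³} → ℕ^{K'³}`. [folklore] -/
def coarsenCount (K' : ℕ) (m : SubIdx (2 * K') → ℕ) : SubIdx K' → ℕ :=
  fun P => ∑ C ∈ children (2 * K') P, m C

/-- `π ∘ m^{(ℓ)} = m^{(2ℓ)}`: the coarse count field is a statistic of the fine one. [folklore] -/
theorem coarsenCount_comp_countVec {K' : ℕ} {ℓ : ℝ} (hℓ : 0 < ℓ) :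
    (coarsenCount K') ∘ (countVec (n := n) ℓ (2 * K')) = countVec (2 * ℓ) K' := by
  funext Y
  funext P
  simp only [Function.comp_apply, coarsenCount]
  exact (countVec_coarse_eq_sum hℓ Y P).symm

/-! ### Refinement monotonicity of the count affinity -/

/-- **NUM(2K') ≤ NUM(K')**: the count (insertion) affinity is monotone under coarsening of the grid,
`countAffinity L (2K') Φ ≤ countAffinity L K' Φ`.  Proof: (i) for each fine fibre, Cauchy–Schwarz over the ≤ 8
children of a coarse cell and `8^{1/2} w_{2K'} = w_{K'}` turn the fine block sum into the coarse block sum with the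
blocks' masses integrated over the FINE fibre; (ii) data processing (`fibreAffinity_mono_coarse`) along the
children-sum map of count fields coarsens the fibres. [folklore] -/
theorem countAffinity_double_le {L : ℝ} {K' : ℕ} (hL : 0 < L) (hK' : 0 < K') {Φ : Config (n + 1) → ℝ}
    (hΦm : Measurable Φ) : countAffinity L (2 * K') Φ ≤ countAffinity L K' Φ := by
  have hKpos : 0 < 2 * K' := by omega
  have hKr : (0:ℝ) < ((2 * K' : ℕ) : ℝ) := by exact_mod_cast hKpos
  set ℓ := L / ((2 * K' : ℕ) : ℝ) with hℓdef
  have hℓ : 0 < ℓ := div_pos hL hKr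
  have e : L / (K' : ℝ) = 2 * ℓ := by rw [hℓdef]; exact coarse_side hK'
  have hT := measurable_countVec (n := n) ℓ (2 * K')
  -- (i) pointwise in the fine fibre
  have hA : ∀ m' : SubIdx (2 * K') → ℕ,
      ∑ C : SubIdx (2 * K'), blockWeight (2 * K') * fibreMass L (2 * K') Φ C m' ^ (1 / 2 : ℝ) ≤
        ∑ P : SubIdx K', blockWeight K' *
          (∫⁻ Y in countVec ℓ (2 * K') ⁻¹' {m'}, blockMass L K' Φ P Y) ^ (1 / 2 : ℝ) := by
    intro m'
    rw [sum_eq_sum_children (fun C => blockWeight (2 * K') * fibreMass L (2 * K') Φ C m' ^ (1 / 2 : ℝ))]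
    refine Finset.sum_le_sum fun P _ => ?_
    rw [← Finset.mul_sum]
    have hcs := sum_rpow_half_le_sqrt_card_mul (children (2 * K') P)
      (fun C => fibreMass L (2 * K') Φ C m')
    have hsumFM : ∑ C ∈ children (2 * K') P, fibreMass L (2 * K') Φ C m' =
        ∫⁻ Y in countVec ℓ (2 * K') ⁻¹' {m'}, blockMass L K' Φ P Y := by
      unfold fibreMass
      rw [← lintegral_finsetSum _ (fun C _ => measurable_blockMass L (2 * K') hΦm C)]
      exact lintegral_congr fun Y => (blockMass_coarse_eq_sum hL hK' Φ P Y).symm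
    calc blockWeight (2 * K') * ∑ C ∈ children (2 * K') P, fibreMass L (2 * K') Φ C m' ^ (1 / 2 : ℝ)
        ≤ blockWeight (2 * K') * ((((children (2 * K') P).card : ℝ≥0∞) ^ (1 / 2 : ℝ)) *
            (∑ C ∈ children (2 * K') P, fibreMass L (2 * K') Φ C m') ^ (1 / 2 : ℝ)) :=
          mul_le_mul' le_rfl hcs
      _ = (((children (2 * K') P).card : ℝ≥0∞) ^ (1 / 2 : ℝ) * blockWeight (2 * K')) *
            (∑ C ∈ children (2 * K') P, fibreMass L (2 * K') Φ C m') ^ (1 / 2 : ℝ) := by ring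
      _ ≤ blockWeight K' *
            (∫⁻ Y in countVec ℓ (2 * K') ⁻¹' {m'}, blockMass L K' Φ P Y) ^ (1 / 2 : ℝ) := by
          rw [hsumFM]
          exact mul_le_mul' (sqrt_card_children_mul_blockWeight_le hK' P) le_rfl
  -- (ii) coarsen the fibres
  calc countAffinity L (2 * K') Φ
      ≤ ∑' m' : SubIdx (2 * K') → ℕ, fibreSlice L (2 * K') Φ m' ^ (1 / 2 : ℝ) *
          ∑ P : SubIdx K', blockWeight K' *
            (∫⁻ Y in countVec ℓ (2 * K') ⁻¹' {m'}, blockMass L K' Φ P Y) ^ (1 / 2 : ℝ) :=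
        ENNReal.tsum_le_tsum fun m' => mul_le_mul' le_rfl (hA m')
    _ = ∑ P : SubIdx K', blockWeight K' * ∑' m' : SubIdx (2 * K') → ℕ,
          fibreSlice L (2 * K') Φ m' ^ (1 / 2 : ℝ) *
            (∫⁻ Y in countVec ℓ (2 * K') ⁻¹' {m'}, blockMass L K' Φ P Y) ^ (1 / 2 : ℝ) :=
        tsum_mul_sum_swap _ _ _
    _ ≤ ∑ P : SubIdx K', blockWeight K' * ∑' m : SubIdx K' → ℕ,
          fibreSlice L K' Φ m ^ (1 / 2 : ℝ) * fibreMass L K' Φ P m ^ (1 / 2 : ℝ) := by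
        refine Finset.sum_le_sum fun P _ => mul_le_mul' le_rfl ?_
        have h := fibreAffinity_mono_coarse volume hT (coarsenCount K') (sliceSq Φ) (blockMass L K' Φ P)
        rw [coarsenCount_comp_countVec hℓ] at h
        unfold fibreSlice fibreMass
        rw [e]
        exact h
    _ = countAffinity L K' Φ := (tsum_mul_sum_swap _ _ _).symm

/-- Iterated form: `countAffinity L (2^j K) Φ ≤ countAffinity L K Φ`. [folklore] -/
theorem countAffinity_pow_two_mul_le {L : ℝ} {K : ℕ} (hL : 0 < L) (hK : 0 < K) {Φ : Config (n + 1) → ℝ}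
    (hΦm : Measurable Φ) (j : ℕ) : countAffinity L (2 ^ j * K) Φ ≤ countAffinity L K Φ := by
  induction j with
  | zero => simp
  | succ j ih =>
    have hKj : 0 < 2 ^ j * K := Nat.mul_pos (Nat.two_pow_pos j) hK
    calc countAffinity L (2 ^ (j + 1) * K) Φ = countAffinity L (2 * (2 ^ j * K)) Φ := by
          rw [pow_succ]; ring_nf
      _ ≤ countAffinity L (2 ^ j * K) Φ := countAffinity_double_le hL hKj hΦm
      _ ≤ countAffinity L K Φ := ih

/-! ### The parity lift for NUM_h and the equivalence CSUF_h ↔ NUM_h modulo LOC_h -/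

/-- **NUM^e_h(η) ⟹ NUM_h(η)**: for `K` in the window of constant `2M`, `2K` is even and lies in the window of constant
`M`, and `NUM(2K) ≤ NUM(K)` (`countAffinity_double_le`). [folklore] -/
theorem horizonCountAffinity_of_even (η : ℝ≥0) (h : GroundStateHorizonCountAffinityEven η) :
    GroundStateHorizonCountAffinity η := by
  intro v hv ha
  obtain ⟨M₀, hM₀, hM⟩ := h v hv ha
  refine ⟨2 * M₀, by positivity, fun M hMge => ?_⟩
  have hMpos : 0 < M := by linarith
  obtain ⟨c, hc, ρ₀, hρ₀, h'⟩ := hM (M / 2) (by linarith)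
  refine ⟨c, hc, ρ₀, hρ₀, fun ρ hρ hρlt => ?_⟩
  filter_upwards [h' ρ hρ hρlt] with n hn hex K hK hKw
  have hA : 0 < M / 2 * ρ ^ (-(η : ℝ)) := mul_pos (by linarith) (Real.rpow_pos_of_pos hρ _)
  have hKr : (0 : ℝ) < K := by exact_mod_cast hK
  obtain ⟨hw1, hw2⟩ := hKw
  have hKw2 : InWindow (M / 2 * ρ ^ (-(η : ℝ))) ρ (sideLength ρ (n + 1)) (2 * K) := by
    constructor
    · rw [Nat.cast_mul, Nat.cast_two, mul_comm (2:ℝ) (K:ℝ), ← div_div, le_div_iff₀ two_pos]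
      calc M / 2 * ρ ^ (-(η : ℝ)) / Real.sqrt ρ * 2 = M * ρ ^ (-(η : ℝ)) / Real.sqrt ρ := by ring
        _ ≤ sideLength ρ (n + 1) / K := hw1
    · rw [Nat.cast_mul, Nat.cast_two, mul_comm (2:ℝ) (K:ℝ), ← div_div, div_le_iff₀ two_pos]
      calc sideLength ρ (n + 1) / K ≤ 2 * (M * ρ ^ (-(η : ℝ))) / Real.sqrt ρ := hw2
        _ = 2 * (M / 2 * ρ ^ (-(η : ℝ))) / Real.sqrt ρ * 2 := by ring
  have hK2 : 0 < 2 * K := by omega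
  have hL : 0 < sideLength ρ (n + 1) := sideLength_pos_of_inWindow hA hρ hK2 hKw2
  exact (hn hex (2 * K) hK2 (even_two_mul K) hKw2).trans
    (countAffinity_double_le hL hK (measurable_groundState v (n + 1) _))

/-- **LOC_h(η) ∧ CSUF_h(η) ⟹ NUM_h(η)** (0 sorry; DLT_h(η) by `CoercivityLine.densityLLNTrunc_holds`):
parent-scale condensation + cell-count sufficiency give the count (insertion) affinity at every block number of the
window. [folklore] -/
theorem horizonCountAffinity_of_loc (η : ℝ≥0) (hloc : GroundStateHorizonCondensation η)
    (hcsuf : GroundStateHorizonCellCountSufficiency η) : GroundStateHorizonCountAffinity η :=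
  horizonCountAffinity_of_even η (horizonCountAffinityEven_of_cell η
    (horizonCellCountAffinityEven_of_loc η hloc (CoercivityLine.densityLLNTrunc_holds η)) hcsuf)

/-- **CSUF_h(η) ↔ NUM_h(η) given LOC_h(η)**: modulo the energy-class piece, the two «global» leaves of the box
count-shadow line are one statement (`→` above; `←` is the tree's `horizonCellCountSufficiency_of_horizonCountAffinity`).
[folklore] -/
theorem horizonCountSufficiency_iff_countAffinity_of_loc (η : ℝ≥0) (hloc : GroundStateHorizonCondensation η) :
    GroundStateHorizonCellCountSufficiency η ↔ GroundStateHorizonCountAffinity η :=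
  ⟨horizonCountAffinity_of_loc η hloc, horizonCellCountSufficiency_of_horizonCountAffinity η⟩

/-- **MARG_h(η) ⟸ LOC_h(η) ∧ CSUF_h(η)** (SUF_h not needed for the marginal floor). [folklore] -/
theorem horizonCellCountAffinity_of_loc' (η : ℝ≥0) (hloc : GroundStateHorizonCondensation η)
    (hcsuf : GroundStateHorizonCellCountSufficiency η) : GroundStateHorizonCellCountAffinity η :=
  horizonCellCountAffinity_of_horizonCountAffinity η (horizonCountAffinity_of_loc η hloc hcsuf)

end Summit.AtomisticToContinuum.BoseEinsteinCondensation.Theorems.BoxCountShadow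

end
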